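import Summits.SmoothPoincare4.Statement
import Literature.Uncategorized.Crux
import Literature.Barriers.SmoothPoincare4.GluckTwistsDissolve
import Literature.Topology.FourManifolds.ConnectedSumSphereIdentity
import HarnessLib

/-!
# `ZseCruxRasmussen` — negative knowledge III: the price of a witness is an exotic `ℂℙ²`-sum; `ℂℙ²`-rigidity kills the crux

Refuter support lemmas for crux `stmt-SmoothPoincare4-0366` (`Literature.Uncategorized.Crux`: knots `K, K'`
with a common `0`-surgery, `K` smoothly slice, `s(K') ≠ 0`), from the standing disprover's work file
`Summits/SmoothPoincare4/SmoothPoincare4/Cruxes/ZseCruxRasmussen/Disproof.lean` §7, over the catalogue's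
sharpening of the Gluck-twist barrier (`Literature/Barriers/SmoothPoincare4/GluckTwistsDissolve.lean`,
section "Beyond Gluck twists": the named fact `mmsw2023_sZero_of_dissolvesInCP2` = MMSW 2023 §9.3, `r = 1`,
with "`ℂℙ²`-rigidity on homotopy-sphere sums" spelled out as a hypothesis: every closed smooth homotopy
4-sphere `DissolvesInCP2`):

* `exoticCP2Sum_of_crux` — GIVEN MMSW's §9.3 fact, a crux witness yields a closed smooth homotopy 4-sphere
  `X` (the Manolescu–Piccirillo sphere carrying the `K'`-disc, PROVED Lemma 3.3) and a closed smooth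
  connected sum `P` of `X` with `ℂℙ²` admitting NO diffeomorphism to `ℂℙ²`: the `s`-witness 0-surgery
  route to an exotic `S⁴` must also produce an exotic `ℂℙ²` (up to orientation; Manolescu 2026 survey
  arXiv:2601.05425, Question 3.2, case `n = 1`);
* `not_crux_of_cp2Rigid` — GIVEN the §9.3 fact, `ℂℙ²`-rigidity on homotopy-sphere sums kills the crux (that
  rigidity is, on paper, a consequence of the tree's registered open statement
  `Literature.Topology.FourManifolds.NoExoticComplexProjectivePlaneConjecture` — uniqueness of the smooth
  structure on `ℂℙ²` — via Freedman (`Σ ≈ S⁴`), Brown's topological Schoenflies theorem and the Alexander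
  trick (`Σ # ℂℙ² ≈ ℂℙ²`); that topological bridge is not in the tree, so the hypothesis is kept spelled out);
* `dissolvesInCP2_of_spc4` — PROVED: `SmoothPoincare4` implies that rigidity (`X ≅ S⁴`, then
  `ℂℙ² # S⁴ ≅ ℂℙ²` by the tree theorem `nonempty_diffeomorph_of_isConnectedSum_sphere'` transported by
  `IsConnectedSum.of_diffeomorph_left`), so the new kill hypothesis sits between SPC4 and `¬ Crux`;
* `not_crux_of_spc4_of_mmsw2023` — hence SPC4 ⇒ `¬ Crux` mod the §9.3 fact alone (no Rasmussen Thm. 1).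
No definitions; no route item is concluded positively.
References: Manolescu–Marengon–Sarkar–Willis 2023 §9.3, Cor. 6.13/6.15 [ManolescuMarengonSarkarWillis2023];
Manolescu–Piccirillo 2023 Lemma 3.3 [ManolescuPiccirillo2023]; Kervaire–Milnor 1963 §2 [KervaireMilnor1963].
-/

noncomputable section

set_option linter.dupNamespace false

namespace Summit.SmoothPoincare4.SmoothPoincare4.Theorems.ZseCruxRasmussen.Negative

open scoped Manifold ContDiff
open ContinuousMap
open Literature.Topology.FourManifolds Literature.Barriers.SmoothPoincare4 Literature.Uncategorized

/-- **The price of a crux witness: an exotic `ℂℙ²`-sum** (GIVEN MMSW 2023 §9.3, `r = 1`): some closed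
smooth homotopy 4-sphere `X` carries a knot with `s ≠ 0` bounding a disc in `X ∖ B̊⁴`, and some closed
smooth connected sum of `X` with `ℂℙ²` is not diffeomorphic to `ℂℙ²`.
[cite: ManolescuMarengonSarkarWillis2023, §9.3] [cite: ManolescuPiccirillo2023, Lemma 3.3] -/
theorem exoticCP2Sum_of_crux (hM : mmsw2023_sZero_of_dissolvesInCP2) (h : Crux) :
    ∃ (X : Type) (_ : TopologicalSpace X) (_ : T2Space X) (_ : SecondCountableTopology X)
      (_ : ChartedSpace (EuclideanSpace ℝ (Fin 4)) X) (_ : IsManifold (𝓡 4) ∞ X) (_ : CompactSpace X),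
      Nonempty (X ≃ₕ (Metric.sphere (0 : EuclideanSpace ℝ (Fin 5)) 1)) ∧
      (∃ (K : Knot) (e : EuclideanSpace ℝ (Fin 4) → X) (f : EuclideanSpace ℝ (Fin 2) → X) (s : ℤ),
        K.IsSliceDiscIn X e f ∧ K.HasRasmussenInvariant s ∧ s ≠ 0) ∧
      ∃ (P : Type) (_ : TopologicalSpace P) (_ : T2Space P) (_ : SecondCountableTopology P)
        (_ : ChartedSpace (EuclideanSpace ℝ (Fin 4)) P) (_ : IsManifold (𝓡 4) ∞ P) (_ : CompactSpace P),
        IsConnectedSum (𝓡 4) (𝓡 4) (𝓡 4) X ComplexProjectivePlane P ∧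
          IsEmpty (P ≃ₘ⟮𝓡 4, 𝓡 4⟯ ComplexProjectivePlane) :=
  exoticCP2Sum_of_fgmwRasmussenStrategy hM (fgmwRasmussenStrategy_of_crux h)

/-- **`ℂℙ²`-rigidity on homotopy-sphere sums kills the crux** (GIVEN MMSW 2023 §9.3, `r = 1`).
[cite: ManolescuMarengonSarkarWillis2023, §9.3] -/
theorem not_crux_of_cp2Rigid (hM : mmsw2023_sZero_of_dissolvesInCP2)
    (hC : ∀ (X : Type) [TopologicalSpace X] [T2Space X] [SecondCountableTopology X]
      [ChartedSpace (EuclideanSpace ℝ (Fin 4)) X] [IsManifold (𝓡 4) ∞ X] [CompactSpace X],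
      Nonempty (X ≃ₕ (Metric.sphere (0 : EuclideanSpace ℝ (Fin 5)) 1)) → DissolvesInCP2 X) :
    ¬ Crux :=
  not_crux_iff_sVanishesOnPairs.2
    (sVanishesOnPairs_of_mmsw2023Question911Knot (mmsw2023Question911Knot_of_cp2Rigid hM hC))

/-- **SPC4 ⇒ `ℂℙ²`-rigidity on homotopy-sphere sums** (PROVED from tree theorems): under SPC4 a closed
smooth homotopy 4-sphere `X` is `≅ S⁴`; transport the sum along the diffeomorphism and use
`ℂℙ² # S⁴ ≅ ℂℙ²` (Kervaire–Milnor, "`Sⁿ` serves as identity"). [cite: KervaireMilnor1963, §2] -/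
theorem dissolvesInCP2_of_spc4 (hS : _root_.SmoothPoincare4) (X : Type) [TopologicalSpace X]
    [T2Space X] [SecondCountableTopology X] [ChartedSpace (EuclideanSpace ℝ (Fin 4)) X]
    [IsManifold (𝓡 4) ∞ X] [CompactSpace X]
    (hX : Nonempty (X ≃ₕ (Metric.sphere (0 : EuclideanSpace ℝ (Fin 5)) 1))) : DissolvesInCP2 X := by
  intro P _ _ _ _ _ _ hP
  obtain ⟨e⟩ := hX
  obtain ⟨d⟩ := hS X ‹_› ‹_› e
  exact nonempty_diffeomorph_of_isConnectedSum_sphere' ((hP.of_diffeomorph_left d).symm)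

/-- Hence SPC4 kills the crux GIVEN MMSW's §9.3 fact alone (a second derivation of `not_crux_of_spc4`,
trading Rasmussen's Theorem 1 for the dissolution lemma). [cite: ManolescuMarengonSarkarWillis2023, §9.3] -/
theorem not_crux_of_spc4_of_mmsw2023 (hM : mmsw2023_sZero_of_dissolvesInCP2)
    (hS : _root_.SmoothPoincare4) : ¬ Crux :=
  not_crux_of_cp2Rigid hM fun X _ _ _ _ _ _ hX ↦ dissolvesInCP2_of_spc4 hS X hX

end Summit.SmoothPoincare4.SmoothPoincare4.Theorems.ZseCruxRasmussen.Negative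

end
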